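import Summits.Schanuel.Schanuel.Theorems.ZilberEacHyperellipticSheetFibres
import Summits.Schanuel.Schanuel.Theorems.ZilberEacConicSheetFibres
import Summits.Schanuel.Schanuel.Theorems.ZilberEacCyclicCoverSheetFibres
import Summits.Schanuel.Schanuel.Theorems.ZilberEacFibrationProj
import HarnessLib

/-!
# Arbitrary base branches, LII: EVERY non-constant polynomial fibre over EVERY cyclic cover
# `x₁^k = P(x₀)` — the summary; examples

HONEST FRAMING.  Cell `pub-schanuel` (Zilber's Exponential-Algebraic Closedness, case ladder;
host summit Schanuel), seat 2, gen 30.  Files L (the conics, `deg P = 2`, transcendence method) and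
LI (`deg P ≠ 2`, growth along the flat sheets) are joined:
**`unprojectedDensityQuestion_quadricCover_polyFibre`** — for EVERY monic `P` of degree `≥ 1` with
a simple root and EVERY `R ∈ ℂ[x₀, x₁]` taking two different values on `C : x₁² = P(x₀)`, the surface
`{x₁² − P(x₀) = 0, y₀ = R(x₀, x₁)}` is in Mantova–Masser's case AND has Zariski-dense exponential
points; the sheet form **`unprojectedDensityQuestion_quadricCover_sheetFibre`** (`y₀ = A(x₀) + x₁B(x₀)`,
`B ≠ 0 ∨ deg A ≥ 1`).  So over the curves `x₁² = P(x₀)` Mantova–Masser's typed question is decided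
for every non-constant polynomial fibre; what remains over these bases are the CONSTANT fibres on one
circle when `deg P ≡ 2 (mod 4)`, `deg P ≥ 6` (file XLV), fibres involving `y₁`, and fibre curves
`F(x₀, x₁, y₀) = 0` of positive genus in `y₀`.  For `k ≥ 3` file LIII (b) gives the same for every
polynomial fibre nonzero somewhere on the curve; **`unprojectedDensityQuestion_cyclicCover_polyFibreMv_all`**
packages both: `k ≥ 2`, `P` monic of degree `≥ 1` with a simple root, `R` taking two different values
on `C`; by THEOREM F′ of gen 5 every irreducible threefold of `ℂ³ × ℂ³` fibred in curves over such a
surface meets `Γ_exp` (**`inter_expGraph_nonempty_of_fibred_over_cyclicCover_polyFibre`**, new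
unconditional members of the OPEN cell EC(3,2)).  Examples over the elliptic curve `x₁² = x₀³ + 1`
and the Fermat cubic `x₁³ = x₀³ + 1`.
Decided instances of an OPEN question (Mantova–Masser, PLMS 2024 §1 p. 5); EC(3,2) OPEN; NOT
Schanuel's conjecture (neither used nor implied); EAC ⇏ SC.
-/

noncomputable section

open Filter Topology Set Complex Polynomial
open Literature.NumberTheory.Transcendental Literature.ModelTheory.Zilber
open Literature.ModelTheory.ExponentialFields

set_option linter.dupNamespace false

namespace Summit.Schanuel.Schanuel.Theorems

section QuadricCover

variable (P A B : ℂ[X])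

/-! ## Part A. All degrees -/

/-- **`y₀ = A(x₀) + x₁B(x₀)` over `x₁² = P(x₀)`, every degree: case ∧ dense** (`P` monic of degree
`≥ 1` with a simple root; `B ≠ 0 ∨ deg A ≥ 1`). [cite: MantovaMasser2023, §1 Further remarks, p. 5
(the question, open in general)] (new) -/
theorem unprojectedDensityQuestion_quadricCover_sheetFibre (hAB : B ≠ 0 ∨ 1 ≤ A.natDegree)
    (hP : P.Monic) (hM : 1 ≤ P.natDegree) {r : ℂ} (hr : P.IsRoot r)
    (hr1 : P.derivative.eval r ≠ 0) :
    MMCaseDimPiOneFree {w : Fin 2 ⊕ Fin 2 → ℂ |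
        MvPolynomial.eval ![w (Sum.inl 0), w (Sum.inl 1)]
            (MvPolynomial.X 1 ^ 2 - Polynomial.aeval (MvPolynomial.X 0 : MvPolynomial (Fin 2) ℂ) P) = 0 ∧
        w (Sum.inr 0) = MvPolynomial.eval ![w (Sum.inl 0), w (Sum.inl 1)]
          (Polynomial.aeval (MvPolynomial.X 0 : MvPolynomial (Fin 2) ℂ) A +
            MvPolynomial.X 1 * Polynomial.aeval (MvPolynomial.X 0 : MvPolynomial (Fin 2) ℂ) B)} ∧
      UnprojectedDense {w : Fin 2 ⊕ Fin 2 → ℂ |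
        MvPolynomial.eval ![w (Sum.inl 0), w (Sum.inl 1)]
            (MvPolynomial.X 1 ^ 2 - Polynomial.aeval (MvPolynomial.X 0 : MvPolynomial (Fin 2) ℂ) P) = 0 ∧
        w (Sum.inr 0) = MvPolynomial.eval ![w (Sum.inl 0), w (Sum.inl 1)]
          (Polynomial.aeval (MvPolynomial.X 0 : MvPolynomial (Fin 2) ℂ) A +
            MvPolynomial.X 1 * Polynomial.aeval (MvPolynomial.X 0 : MvPolynomial (Fin 2) ℂ) B)} := by
  by_cases h2 : P.natDegree = 2
  · have hAB' : A ≠ 0 ∨ B ≠ 0 := by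
      rcases hAB with hB | hA
      · exact Or.inr hB
      · left
        rintro rfl
        simp at hA
    exact unprojectedDensityQuestion_conic_sheetFibre P A B hAB' hP h2 hr hr1
  · exact unprojectedDensityQuestion_hyperelliptic_sheetFibre P A B hAB hP hM h2 hr hr1

/-- **EVERY non-constant polynomial fibre over EVERY `x₁² = P(x₀)`: case ∧ dense.**  `P` monic of
degree `≥ 1` with a simple root; `R ∈ ℂ[x₀, x₁]` taking two different values on the curve:
`{x₁² − P(x₀) = 0, y₀ = R(x₀, x₁)}` is in Mantova–Masser's case AND has Zariski-dense exponential
points. [cite: MantovaMasser2023, §1 Further remarks, p. 5 (the question, open in general)] (new) -/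
theorem unprojectedDensityQuestion_quadricCover_polyFibre (R : MvPolynomial (Fin 2) ℂ)
    (hR : ∃ x y : Fin 2 → ℂ,
      MvPolynomial.eval x
          (MvPolynomial.X 1 ^ 2 - Polynomial.aeval (MvPolynomial.X 0 : MvPolynomial (Fin 2) ℂ) P) = 0 ∧
        MvPolynomial.eval y
          (MvPolynomial.X 1 ^ 2 - Polynomial.aeval (MvPolynomial.X 0 : MvPolynomial (Fin 2) ℂ) P) = 0 ∧
        MvPolynomial.eval x R ≠ MvPolynomial.eval y R)
    (hP : P.Monic) (hM : 1 ≤ P.natDegree) {r : ℂ} (hr : P.IsRoot r)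
    (hr1 : P.derivative.eval r ≠ 0) :
    MMCaseDimPiOneFree {w : Fin 2 ⊕ Fin 2 → ℂ |
        MvPolynomial.eval ![w (Sum.inl 0), w (Sum.inl 1)]
            (MvPolynomial.X 1 ^ 2 - Polynomial.aeval (MvPolynomial.X 0 : MvPolynomial (Fin 2) ℂ) P) = 0 ∧
        w (Sum.inr 0) = MvPolynomial.eval ![w (Sum.inl 0), w (Sum.inl 1)] R} ∧
      UnprojectedDense {w : Fin 2 ⊕ Fin 2 → ℂ |
        MvPolynomial.eval ![w (Sum.inl 0), w (Sum.inl 1)]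
            (MvPolynomial.X 1 ^ 2 - Polynomial.aeval (MvPolynomial.X 0 : MvPolynomial (Fin 2) ℂ) P) = 0 ∧
        w (Sum.inr 0) = MvPolynomial.eval ![w (Sum.inl 0), w (Sum.inl 1)] R} := by
  obtain ⟨A', B', Q, hRAB⟩ := exists_hyperelliptic_reduction P R
  rw [curveGraphFibre_eq_of_reduction P A' B' R Q hRAB]
  exact unprojectedDensityQuestion_quadricCover_sheetFibre P A' B'
    (reduction_nonconstant P A' B' R Q hRAB hR) hP hM hr hr1

/-- **Plain coordinates**, every degree: `{x₁² − P(x₀) = 0, y₀ = A(x₀) + x₁B(x₀)}` is in the case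
AND dense. [cite: MantovaMasser2023, §1 Further remarks, p. 5 (the question, open in general)]
(new) -/
theorem unprojectedDensityQuestion_quadricCover_sheetFibre' (hAB : B ≠ 0 ∨ 1 ≤ A.natDegree)
    (hP : P.Monic) (hM : 1 ≤ P.natDegree) {r : ℂ} (hr : P.IsRoot r)
    (hr1 : P.derivative.eval r ≠ 0) :
    MMCaseDimPiOneFree {w : Fin 2 ⊕ Fin 2 → ℂ |
        w (Sum.inl 1) ^ 2 - P.eval (w (Sum.inl 0)) = 0 ∧
        w (Sum.inr 0) = A.eval (w (Sum.inl 0)) + w (Sum.inl 1) * B.eval (w (Sum.inl 0))} ∧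
      UnprojectedDense {w : Fin 2 ⊕ Fin 2 → ℂ |
        w (Sum.inl 1) ^ 2 - P.eval (w (Sum.inl 0)) = 0 ∧
        w (Sum.inr 0) = A.eval (w (Sum.inl 0)) + w (Sum.inl 1) * B.eval (w (Sum.inl 0))} := by
  rw [← sheetFibre_setOf_eq]
  exact unprojectedDensityQuestion_quadricCover_sheetFibre P A B hAB hP hM hr hr1

/-! ## Part A'. Every cyclic cover `x₁^k = P(x₀)`, `k ≥ 2` -/

/-- **EVERY non-constant polynomial fibre over EVERY cyclic cover `x₁^k = P(x₀)`, `k ≥ 2`: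
case ∧ dense.**  `P` monic of degree `≥ 1` with a simple root; `R ∈ ℂ[x₀, x₁]` taking two
different values on the curve. [cite: MantovaMasser2023, §1 Further remarks, p. 5 (the question,
open in general)] (new) -/
theorem unprojectedDensityQuestion_cyclicCover_polyFibreMv_all {k : ℕ} (hk : 2 ≤ k) (hP : P.Monic)
    (hM : 1 ≤ P.natDegree) {r : ℂ} (hr : P.IsRoot r) (hr1 : P.derivative.eval r ≠ 0)
    (R : MvPolynomial (Fin 2) ℂ)
    (hR : ∃ x y : Fin 2 → ℂ,
      MvPolynomial.eval x
          (MvPolynomial.X 1 ^ k - Polynomial.aeval (MvPolynomial.X 0 : MvPolynomial (Fin 2) ℂ) P) = 0 ∧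
        MvPolynomial.eval y
          (MvPolynomial.X 1 ^ k - Polynomial.aeval (MvPolynomial.X 0 : MvPolynomial (Fin 2) ℂ) P) = 0 ∧
        MvPolynomial.eval x R ≠ MvPolynomial.eval y R) :
    MMCaseDimPiOneFree {w : Fin 2 ⊕ Fin 2 → ℂ |
        MvPolynomial.eval ![w (Sum.inl 0), w (Sum.inl 1)]
            (MvPolynomial.X 1 ^ k - Polynomial.aeval (MvPolynomial.X 0 : MvPolynomial (Fin 2) ℂ) P) = 0 ∧
        w (Sum.inr 0) = MvPolynomial.eval ![w (Sum.inl 0), w (Sum.inl 1)] R} ∧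
      UnprojectedDense {w : Fin 2 ⊕ Fin 2 → ℂ |
        MvPolynomial.eval ![w (Sum.inl 0), w (Sum.inl 1)]
            (MvPolynomial.X 1 ^ k - Polynomial.aeval (MvPolynomial.X 0 : MvPolynomial (Fin 2) ℂ) P) = 0 ∧
        w (Sum.inr 0) = MvPolynomial.eval ![w (Sum.inl 0), w (Sum.inl 1)] R} := by
  by_cases hk2 : k = 2
  · subst hk2
    exact unprojectedDensityQuestion_quadricCover_polyFibre P R hR hP hM hr hr1
  · have hk3 : 3 ≤ k := by omega
    obtain ⟨x, y, hx, hy, hxy⟩ := hR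
    have hne : ∃ x : Fin 2 → ℂ, MvPolynomial.eval x
        (MvPolynomial.X 1 ^ k - Polynomial.aeval (MvPolynomial.X 0 : MvPolynomial (Fin 2) ℂ) P) = 0 ∧
          MvPolynomial.eval x R ≠ 0 := by
      by_cases h0 : MvPolynomial.eval x R = 0
      · refine ⟨y, hy, fun h => hxy ?_⟩
        rw [h0, h]
      · exact ⟨x, hx, h0⟩
    exact unprojectedDensityQuestion_cyclicCover_polyFibreMv P hk3 hP hM hr hr1 R hne

/-- **Members of `EC(3,2)` over the polynomial-fibre cylinders.**  A threefold `W ⊆ ℂ³ × ℂ³`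
(irreducible closed, meeting `G³`, of dimension `3`, torus part fibred in curves) whose projected
surface is `{x₁^k = P(x₀), y₀ = R(x₀, x₁)}` (`k ≥ 2`, `P` monic of degree `≥ 1` with a simple root,
`R` taking two values on the curve) meets `Γ_exp`. [cite: MantovaMasser2023, §1 Further remarks,
p. 5] (new) -/
theorem inter_expGraph_nonempty_of_fibred_over_cyclicCover_polyFibre {k : ℕ} (hk : 2 ≤ k)
    (hP : P.Monic) (hM : 1 ≤ P.natDegree) {r : ℂ} (hr : P.IsRoot r)
    (hr1 : P.derivative.eval r ≠ 0) (R : MvPolynomial (Fin 2) ℂ)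
    (hR : ∃ x y : Fin 2 → ℂ,
      MvPolynomial.eval x
          (MvPolynomial.X 1 ^ k - Polynomial.aeval (MvPolynomial.X 0 : MvPolynomial (Fin 2) ℂ) P) = 0 ∧
        MvPolynomial.eval y
          (MvPolynomial.X 1 ^ k - Polynomial.aeval (MvPolynomial.X 0 : MvPolynomial (Fin 2) ℂ) P) = 0 ∧
        MvPolynomial.eval x R ≠ MvPolynomial.eval y R)
    {W : Set (Fin (2 + 1) ⊕ Fin (2 + 1) → ℂ)}
    (hW : IsIrreducibleClosed ℂ W) (hne : (W ∩ torusLocus ℂ (2 + 1)).Nonempty)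
    (hdim : zariskiDim ℂ W = (2 + 1 : ℕ))
    (hfib : zariskiDim ℂ (matrixAct (dropLastMat 2) '' (W ∩ torusLocus ℂ (2 + 1))) = (2 : ℕ))
    (hproj : MvPolynomial.zeroLocus ℂ (MvPolynomial.vanishingIdeal ℂ
      ((fun (w : Fin (2 + 1) ⊕ Fin (2 + 1) → ℂ) (t : Fin 2 ⊕ Fin 2) =>
        w (Sum.map Fin.castSucc Fin.castSucc t)) '' (W ∩ torusLocus ℂ (2 + 1)))) =
      {w : Fin 2 ⊕ Fin 2 → ℂ |
        MvPolynomial.eval ![w (Sum.inl 0), w (Sum.inl 1)]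
            (MvPolynomial.X 1 ^ k - Polynomial.aeval (MvPolynomial.X 0 : MvPolynomial (Fin 2) ℂ) P) = 0 ∧
        w (Sum.inr 0) = MvPolynomial.eval ![w (Sum.inl 0), w (Sum.inl 1)] R}) :
    (W ∩ expGraph ℂ (2 + 1)).Nonempty := by
  refine inter_expGraph_nonempty_of_unprojectedDense_proj hW hne hdim hfib ?_
  rw [hproj]
  exact (unprojectedDensityQuestion_cyclicCover_polyFibreMv_all P hk hP hM hr hr1 R hR).2

end QuadricCover

/-! ## Part B. Examples over the elliptic curve `x₁² = x₀³ + 1` -/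

/-- The curve data: `x³ + 1` is monic of degree `3` with the simple root `−1`. -/
theorem fermatCubic_data :
    (Polynomial.X ^ 3 + 1 : ℂ[X]).Monic ∧ (Polynomial.X ^ 3 + 1 : ℂ[X]).natDegree = 3 ∧
      (Polynomial.X ^ 3 + 1 : ℂ[X]).IsRoot (-1) ∧
      (Polynomial.derivative (Polynomial.X ^ 3 + 1 : ℂ[X])).eval (-1) ≠ 0 := by
  refine ⟨?_, ?_, ?_, ?_⟩
  · simpa using Polynomial.monic_X_pow_add_C (1 : ℂ) (by norm_num : (3 : ℕ) ≠ 0)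
  · simpa using Polynomial.natDegree_X_pow_add_C (n := 3) (r := (1 : ℂ))
  · simp [Polynomial.IsRoot]
    norm_num
  · rw [Polynomial.derivative_add, Polynomial.derivative_one, Polynomial.derivative_X_pow, add_zero,
      Polynomial.eval_mul, Polynomial.eval_C, Polynomial.eval_pow, Polynomial.eval_X]
    norm_num

/-- Example: `{x₁² = x₀³ + 1, y₀ = x₀ + x₁}`: case ∧ dense.
[cite: MantovaMasser2023, §1 Further remarks, p. 5 (the question, open in general)] (new) -/
theorem unprojectedDensityQuestion_ellipticFermat_fibre_x₀_add_x₁ :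
    MMCaseDimPiOneFree {w : Fin 2 ⊕ Fin 2 → ℂ |
        w (Sum.inl 1) ^ 2 - (Polynomial.X ^ 3 + 1 : ℂ[X]).eval (w (Sum.inl 0)) = 0 ∧
        w (Sum.inr 0) = w (Sum.inl 0) + w (Sum.inl 1)} ∧
      UnprojectedDense {w : Fin 2 ⊕ Fin 2 → ℂ |
        w (Sum.inl 1) ^ 2 - (Polynomial.X ^ 3 + 1 : ℂ[X]).eval (w (Sum.inl 0)) = 0 ∧
        w (Sum.inr 0) = w (Sum.inl 0) + w (Sum.inl 1)} := by
  obtain ⟨hm, hd, hr, hr1⟩ := fermatCubic_data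
  have e : {w : Fin 2 ⊕ Fin 2 → ℂ |
        w (Sum.inl 1) ^ 2 - (Polynomial.X ^ 3 + 1 : ℂ[X]).eval (w (Sum.inl 0)) = 0 ∧
        w (Sum.inr 0) = (Polynomial.X : ℂ[X]).eval (w (Sum.inl 0)) +
          w (Sum.inl 1) * (1 : ℂ[X]).eval (w (Sum.inl 0))} =
      {w : Fin 2 ⊕ Fin 2 → ℂ |
        w (Sum.inl 1) ^ 2 - (Polynomial.X ^ 3 + 1 : ℂ[X]).eval (w (Sum.inl 0)) = 0 ∧
        w (Sum.inr 0) = w (Sum.inl 0) + w (Sum.inl 1)} := by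
    ext w
    simp only [Set.mem_setOf_eq, Polynomial.eval_X, Polynomial.eval_one, mul_one]
  have h := unprojectedDensityQuestion_quadricCover_sheetFibre' _ Polynomial.X 1
    (Or.inl one_ne_zero) hm (by rw [hd]; norm_num) hr hr1
  rw [e] at h
  exact h

/-- Example: `{x₁² = x₀³ + 1, y₀ = x₀x₁ − x₀²}`: case ∧ dense (the two leading terms along the
principal sheet do not decide; the method needs no leading-term information).
[cite: MantovaMasser2023, §1 Further remarks, p. 5 (the question, open in general)] (new) -/
theorem unprojectedDensityQuestion_ellipticFermat_fibre_mixed :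
    MMCaseDimPiOneFree {w : Fin 2 ⊕ Fin 2 → ℂ |
        w (Sum.inl 1) ^ 2 - (Polynomial.X ^ 3 + 1 : ℂ[X]).eval (w (Sum.inl 0)) = 0 ∧
        w (Sum.inr 0) = w (Sum.inl 0) * w (Sum.inl 1) - w (Sum.inl 0) ^ 2} ∧
      UnprojectedDense {w : Fin 2 ⊕ Fin 2 → ℂ |
        w (Sum.inl 1) ^ 2 - (Polynomial.X ^ 3 + 1 : ℂ[X]).eval (w (Sum.inl 0)) = 0 ∧
        w (Sum.inr 0) = w (Sum.inl 0) * w (Sum.inl 1) - w (Sum.inl 0) ^ 2} := by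
  obtain ⟨hm, hd, hr, hr1⟩ := fermatCubic_data
  have e : {w : Fin 2 ⊕ Fin 2 → ℂ |
        w (Sum.inl 1) ^ 2 - (Polynomial.X ^ 3 + 1 : ℂ[X]).eval (w (Sum.inl 0)) = 0 ∧
        w (Sum.inr 0) = (-Polynomial.X ^ 2 : ℂ[X]).eval (w (Sum.inl 0)) +
          w (Sum.inl 1) * (Polynomial.X : ℂ[X]).eval (w (Sum.inl 0))} =
      {w : Fin 2 ⊕ Fin 2 → ℂ |
        w (Sum.inl 1) ^ 2 - (Polynomial.X ^ 3 + 1 : ℂ[X]).eval (w (Sum.inl 0)) = 0 ∧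
        w (Sum.inr 0) = w (Sum.inl 0) * w (Sum.inl 1) - w (Sum.inl 0) ^ 2} := by
    ext w
    simp only [Set.mem_setOf_eq, Polynomial.eval_X, Polynomial.eval_neg, Polynomial.eval_pow]
    constructor
    · rintro ⟨h1, h2⟩; exact ⟨h1, by rw [h2]; ring⟩
    · rintro ⟨h1, h2⟩; exact ⟨h1, by rw [h2]; ring⟩
  have h := unprojectedDensityQuestion_quadricCover_sheetFibre' _ (-Polynomial.X ^ 2) Polynomial.X
    (Or.inl Polynomial.X_ne_zero) hm (by rw [hd]; norm_num) hr hr1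
  rw [e] at h
  exact h

/-! ## Part C. Example over the Fermat cubic `x₁³ = x₀³ + 1` -/

/-- Example: `{x₁³ = x₀³ + 1, y₀ = x₀ − x₁}`: case ∧ dense (along the principal sheet the fibre value
tends to ZERO — `x₀ − x₁ ∼ −x₀^{-2}/3` —, along the two non-real sheets it has a simple pole; no
leading-term information is needed). [cite: MantovaMasser2023, §1 Further remarks, p. 5 (the
question, open in general)] (new) -/
theorem unprojectedDensityQuestion_fermatCubic_fibre_x₀_sub_x₁ :
    MMCaseDimPiOneFree {w : Fin 2 ⊕ Fin 2 → ℂ |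
        w (Sum.inl 1) ^ 3 - (Polynomial.X ^ 3 + 1 : ℂ[X]).eval (w (Sum.inl 0)) = 0 ∧
        w (Sum.inr 0) = w (Sum.inl 0) - w (Sum.inl 1)} ∧
      UnprojectedDense {w : Fin 2 ⊕ Fin 2 → ℂ |
        w (Sum.inl 1) ^ 3 - (Polynomial.X ^ 3 + 1 : ℂ[X]).eval (w (Sum.inl 0)) = 0 ∧
        w (Sum.inr 0) = w (Sum.inl 0) - w (Sum.inl 1)} := by
  obtain ⟨hm, hd, hr, hr1⟩ := fermatCubic_data
  have e : {w : Fin 2 ⊕ Fin 2 → ℂ |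
        w (Sum.inl 1) ^ 3 - (Polynomial.X ^ 3 + 1 : ℂ[X]).eval (w (Sum.inl 0)) = 0 ∧
        w (Sum.inr 0) = (Polynomial.X : ℂ[X]).eval (w (Sum.inl 0)) +
          w (Sum.inl 1) * (-1 : ℂ[X]).eval (w (Sum.inl 0)) +
          w (Sum.inl 1) ^ 2 * (0 : ℂ[X]).eval (w (Sum.inl 0))} =
      {w : Fin 2 ⊕ Fin 2 → ℂ |
        w (Sum.inl 1) ^ 3 - (Polynomial.X ^ 3 + 1 : ℂ[X]).eval (w (Sum.inl 0)) = 0 ∧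
        w (Sum.inr 0) = w (Sum.inl 0) - w (Sum.inl 1)} := by
    ext w
    simp only [Set.mem_setOf_eq, Polynomial.eval_X, Polynomial.eval_neg, Polynomial.eval_one,
      Polynomial.eval_zero, mul_zero, add_zero, mul_neg, mul_one, sub_eq_add_neg]
  have h := unprojectedDensityQuestion_cyclicCover_threeTermFibre _ (le_refl 3) hm
    (by rw [hd]; norm_num) hr hr1 Polynomial.X (-1) 0
    ⟨0, 1, by norm_num, by simp⟩
  rw [e] at h
  exact h

end Summit.Schanuel.Schanuel.Theorems

end
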